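import Summits.BirchSwinnertonDyer.Rank1Residual.Additive.X4SharpThreeCornerTypeG
import Summits.BirchSwinnertonDyer.Rank1Residual.Additive.X4ExoticWild
import HarnessLib

/-!
# The N11 corner at `p = 3` with the EXOTIC input on the WILD Kodaira types only (cell `b2b-bsdres`,
# team n1011, seat p14 gen 2 — sequel "v4" of n1011-p16's `Additive/X4SharpThreeCornerTypeG.lean`
# p252001 along row T-b9's `Additive/X4ExoticWild.lean` p256589)

HONEST FRAMING (cell `b2b-bsdres`, run/shared/lean/b2b/bsd-rank1-residual/, verbatim in every
file): the goal of the cell is to DELETE the COMBINATION-SHAPED residual classes of the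
Birch–Swinnerton-Dyer formula for ALL analytic-rank `≤ 1` elliptic curves over `ℚ` — "full BSD
formula for every rank `≤ 1` curve in class `C`" assembled STRICTLY from published theorems — so
that the rank-`≤ 1` remainder becomes exactly the CONSTRUCTION-SHAPED classes, which are TYPED
(missing-input `Prop`s), NOT attempted. This is not "finishing BSD". Team n1011 (N10 / N11):
research route; prove what is provable now; no claim beyond the stated classes; X4 stays
CONSTRUCTION-SHAPED; the N11 mark is UNCHANGED by this file; nothing is booked. Theorems only (no
definition, no named fact minted; every published input is an explicit named-fact hypothesis).

## What and why

Fourth sibling of `Additive/X4SharpThreeCorner.lean` (p250028) / `…NoLemma20.lean` (p250846) /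
`…TypeG.lean` (p252001, n1011-p16).  Row T-b9 'tame tower at 3' (n1011-p14 with p02, p04) made the
`3`-adic tower from surj(3) a THEOREM on every Kodaira `III` / `III*` row at `3`
(`GaloisImage.towerSurj_three_of_surj_of_kodairaSymbolAt_eq_III/_eq_IIIstar`, p256287), hence on
every TAME row of X4 at `3` (`Iₙ*`, `III`, `III*`: `ClassX4.towerSurj_three_of_surj_of_kodairaSymbolAt_not_wild`),
and confined the EXOTIC residue (surj(3), tower fails) to the Kodaira types `II, IV, IV*, II*`
(`ClassX4.kodairaSymbolAt_wild_of_not_towerSurj_three`, `exotic_iff_exotic_of_kodairaWild`, p256589).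
This file restates p16's eight per-pair / non-residue / class-level corner theorems accordingly
(names `…_wild`, `x4SharpThreeUnitFree_iff_lower_and_residues_exoticWild`): the EXOTIC input is asked
ONLY on the rows whose Kodaira symbol at the place `(3)` of `ℤ` is `II`, `IV`, `IV*` or `II*`
(the wild potentially supersingular rows, `v₃(N) ≥ 3`), and on the NON-RESIDUE side "Kodaira type
not in `{II, IV, IV*, II*}`" may stand in for the tower certificate.  Binders = the end-state of
record's eight (hCT hKatoS hDel hGZK hmod hmodD hKatoχ hK).  Counts of record unchanged
(RESIDUAL-MAP §I N11; census reading `HOME/b2b-bsdres-n1011-p14/tb1/T-b1-ENGINE1-v1.2-ADDENDUM.md`: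
EXOTIC universe = 20 970 surj(3) wild cells of X4@3 `r_an = 0`); N11 stays NEEDS; nothing booked.

References: Kato 2004 [Kato2004Asterisque] Thm. 14.5 (3) (p. 236), (12.5.2) (p. 222), Thm. 17.4 (3)
(p. 273); Delbourgo 1998 [Delbourgo1998] Prop. 4 (p. 144); Wuthrich 2014 [Wuthrich2014] Lemma 20
(p. 399); Cassels 1962 / Silverman *AEC* X.4.14 [SilvermanAEC2009]; Kim 2026 [Kim2022StructureSelmer]
Conj. 1.10; Miller 2011 [Miller2011LMS] Def. 1.1; Silverman *ATAEC* IV.9.4 [SilvermanATAEC1994].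
-/

noncomputable section

open scoped Classical

open WeierstrassCurve Literature.NumberTheory.EllipticCurves
  Literature.NumberTheory.EllipticCurves.ModularForms
  Literature.NumberTheory.EllipticCurves.Rank1Residual
  Literature.NumberTheory.EllipticCurves.Rank1Residual.Typed

namespace Summit.BirchSwinnertonDyer.Rank1Residual.Additive

variable (W : WeierstrassCurve ℚ) [W.IsElliptic] [W.IsGloballyMinimal]

/-! ### §1 One curve at `p = 3`: the upper half from the facts and the four residue inputs, EXOTIC on wild rows -/

/-- **The N11 corner, per pair, EXOTIC asked on the wild Kodaira types only.**  `W` globally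
minimal with `r_an = 0`, `ClassX4 W 3` and `ρ̄_{E,3}` onto; granted the eight published inputs and,
FOR THIS CURVE, the four residue inputs with EXOTIC now reading "`ord₃ j ≥ 0`, Kodaira type `II`,
`IV`, `IV*` or `II*` at `3`, tower fails ⟹ upper": the upper half `MissingUpperBoundAt W 3` holds
(p16's `X4RankZero.missingUpperBoundAt_three_of_residueInputs_typeG` + T-b9's
`ClassX4.kodairaSymbolAt_wild_of_not_towerSurj_three`). [cite: Kato2004Asterisque, Thm. 14.5 (3) (p. 236), Thm. 17.4 (3) (p. 273)]
[cite: Delbourgo1998, Prop. 4 (p. 144)] [cite: SilvermanAEC2009, Thm. X.4.14] [cite: Miller2011LMS, Def. 1.1]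
[cite: Wuthrich2014, Lemma 20 (p. 399)] -/
theorem X4RankZero.missingUpperBoundAt_three_of_residueInputs_wild [Fact (Nat.Prime 3)]
    (hCT : exists_casselsTate_pairing (K := ℚ))
    (hKatoS : Kato2004.rankZero_padicValNat_sha_le_sub_localTamagawa_of_additive_potGood_of_imageContainsSL2)
    (hDel : Delbourgo1998.prop4_rankZero_pow_dvd_constantCoeff)
    (hGZK : rank_eq_analyticRank_of_analyticRank_le_one) (hmod : hasEntireLFunction_rat)
    (hmodD : nonempty_modularParametrizationData)
    (hKatoχ : Wuthrich2014.kato_halfEigenCharIdeal_dvd_cyclotomicPrime_of_surjective)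
    (hK : Kato2004.charIdeal_dvd_padicLFunctionBranch_component_of_surjective)
    (hr : W.analyticRank = 0) (hX : ClassX4 W 3) (hs : Surj W 3)
    (hexotic : 0 ≤ padicValRat 3 W.j →
      (W.kodairaSymbolAt (placeOf 3) = .II ∨ W.kodairaSymbolAt (placeOf 3) = .IV ∨
        W.kodairaSymbolAt (placeOf 3) = .IVstar ∨ W.kodairaSymbolAt (placeOf 3) = .IIstar) →
      ¬ (∀ n : ℕ, W.HasSurjectiveModNGaloisRep (3 ^ n : ℕ)) → MissingUpperBoundAt W 3)
    (htam : 0 ≤ padicValRat 3 W.j → ¬ (TypeGOrd W 3 ∧ semistabilityIndex W 3 = 2) →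
      padicValNat 3 ((W.baseChange ℚ_[3]).localTamagawaNumber ℤ_[3]) + 2 ≤
        padicValNat 3 W.tamagawaProduct → MissingUpperBoundAt W 3)
    (hodd : 0 ≤ padicValRat 3 W.j → ¬ (TypeGOrd W 3 ∧ semistabilityIndex W 3 = 2) →
      (∃ q : ℚ, shaAn W = (q : ℂ) ∧ Odd (padicValRat 3 q)) → MissingUpperBoundAt W 3)
    (hmanin : 0 ≤ padicValRat 3 W.j → ¬ (TypeGOrd W 3 ∧ semistabilityIndex W 3 = 2) →
      (∀ (N : ℕ) [NeZero N] (D : ModularParametrizationData W N), (3 : ℤ) ∣ D.maninConstant) →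
      MissingUpperBoundAt W 3) :
    MissingUpperBoundAt W 3 :=
  X4RankZero.missingUpperBoundAt_three_of_residueInputs_typeG W hCT hKatoS hDel hGZK hmod hmodD hKatoχ hK
    hr hX hs (fun hj _ hnot ↦
      hexotic hj (ClassX4.kodairaSymbolAt_wild_of_not_towerSurj_three hX hs hnot) hnot) htam hodd hmanin

/-- **Per pair at `3`, granted the residue inputs (EXOTIC on wild rows): the typed missing input is
EXACTLY the LOWER half** (`MissingPPartAt W 3 ↔ MissingLowerBoundAt W 3`).
[cite: Kato2004Asterisque, Thm. 14.5 (3) (p. 236)] [cite: Delbourgo1998, Prop. 4 (p. 144)] [cite: Miller2011LMS, Def. 1.1] -/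
theorem X4RankZero.missingPPartAt_three_iff_lower_of_residueInputs_wild [Fact (Nat.Prime 3)]
    (hCT : exists_casselsTate_pairing (K := ℚ))
    (hKatoS : Kato2004.rankZero_padicValNat_sha_le_sub_localTamagawa_of_additive_potGood_of_imageContainsSL2)
    (hDel : Delbourgo1998.prop4_rankZero_pow_dvd_constantCoeff)
    (hGZK : rank_eq_analyticRank_of_analyticRank_le_one) (hmod : hasEntireLFunction_rat)
    (hmodD : nonempty_modularParametrizationData)
    (hKatoχ : Wuthrich2014.kato_halfEigenCharIdeal_dvd_cyclotomicPrime_of_surjective)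
    (hK : Kato2004.charIdeal_dvd_padicLFunctionBranch_component_of_surjective)
    (hr : W.analyticRank = 0) (hX : ClassX4 W 3) (hs : Surj W 3)
    (hexotic : 0 ≤ padicValRat 3 W.j →
      (W.kodairaSymbolAt (placeOf 3) = .II ∨ W.kodairaSymbolAt (placeOf 3) = .IV ∨
        W.kodairaSymbolAt (placeOf 3) = .IVstar ∨ W.kodairaSymbolAt (placeOf 3) = .IIstar) →
      ¬ (∀ n : ℕ, W.HasSurjectiveModNGaloisRep (3 ^ n : ℕ)) → MissingUpperBoundAt W 3)
    (htam : 0 ≤ padicValRat 3 W.j → ¬ (TypeGOrd W 3 ∧ semistabilityIndex W 3 = 2) →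
      padicValNat 3 ((W.baseChange ℚ_[3]).localTamagawaNumber ℤ_[3]) + 2 ≤
        padicValNat 3 W.tamagawaProduct → MissingUpperBoundAt W 3)
    (hodd : 0 ≤ padicValRat 3 W.j → ¬ (TypeGOrd W 3 ∧ semistabilityIndex W 3 = 2) →
      (∃ q : ℚ, shaAn W = (q : ℂ) ∧ Odd (padicValRat 3 q)) → MissingUpperBoundAt W 3)
    (hmanin : 0 ≤ padicValRat 3 W.j → ¬ (TypeGOrd W 3 ∧ semistabilityIndex W 3 = 2) →
      (∀ (N : ℕ) [NeZero N] (D : ModularParametrizationData W N), (3 : ℤ) ∣ D.maninConstant) →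
      MissingUpperBoundAt W 3) :
    MissingPPartAt W 3 ↔ MissingLowerBoundAt W 3 :=
  ⟨fun h ↦ (lower_and_upper_of_missingPPartAt W 3 h).1, fun h ↦
    missingPPartAt_of_lower_of_upper W 3 h
      (X4RankZero.missingUpperBoundAt_three_of_residueInputs_wild W hCT hKatoS hDel hGZK hmod hmodD hKatoχ
        hK hr hX hs hexotic htam hodd hmanin)⟩

/-- **Per pair at `3`: `BSD(E,3)` from the LOWER half, granted the residue inputs (EXOTIC on wild rows).**
[cite: Kato2004Asterisque, Thm. 14.5 (3) (p. 236)] [cite: Delbourgo1998, Prop. 4 (p. 144)]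
[cite: Miller2011LMS, §1 and Def. 1.1] -/
theorem X4RankZero.bsdp_three_of_lower_of_residueInputs_wild [Fact (Nat.Prime 3)]
    (hCT : exists_casselsTate_pairing (K := ℚ))
    (hKatoS : Kato2004.rankZero_padicValNat_sha_le_sub_localTamagawa_of_additive_potGood_of_imageContainsSL2)
    (hDel : Delbourgo1998.prop4_rankZero_pow_dvd_constantCoeff)
    (hGZK : rank_eq_analyticRank_of_analyticRank_le_one) (hmod : hasEntireLFunction_rat)
    (hmodD : nonempty_modularParametrizationData)
    (hKatoχ : Wuthrich2014.kato_halfEigenCharIdeal_dvd_cyclotomicPrime_of_surjective)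
    (hK : Kato2004.charIdeal_dvd_padicLFunctionBranch_component_of_surjective)
    (hr : W.analyticRank = 0) (hX : ClassX4 W 3) (hs : Surj W 3)
    (hexotic : 0 ≤ padicValRat 3 W.j →
      (W.kodairaSymbolAt (placeOf 3) = .II ∨ W.kodairaSymbolAt (placeOf 3) = .IV ∨
        W.kodairaSymbolAt (placeOf 3) = .IVstar ∨ W.kodairaSymbolAt (placeOf 3) = .IIstar) →
      ¬ (∀ n : ℕ, W.HasSurjectiveModNGaloisRep (3 ^ n : ℕ)) → MissingUpperBoundAt W 3)
    (htam : 0 ≤ padicValRat 3 W.j → ¬ (TypeGOrd W 3 ∧ semistabilityIndex W 3 = 2) →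
      padicValNat 3 ((W.baseChange ℚ_[3]).localTamagawaNumber ℤ_[3]) + 2 ≤
        padicValNat 3 W.tamagawaProduct → MissingUpperBoundAt W 3)
    (hodd : 0 ≤ padicValRat 3 W.j → ¬ (TypeGOrd W 3 ∧ semistabilityIndex W 3 = 2) →
      (∃ q : ℚ, shaAn W = (q : ℂ) ∧ Odd (padicValRat 3 q)) → MissingUpperBoundAt W 3)
    (hmanin : 0 ≤ padicValRat 3 W.j → ¬ (TypeGOrd W 3 ∧ semistabilityIndex W 3 = 2) →
      (∀ (N : ℕ) [NeZero N] (D : ModularParametrizationData W N), (3 : ℤ) ∣ D.maninConstant) →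
      MissingUpperBoundAt W 3)
    (hlow : MissingLowerBoundAt W 3) : BSDp W 3 :=
  bsdp_of_missingPPartAt W 3 hGZK (by rw [hr]; exact zero_le_one)
    ((X4RankZero.missingPPartAt_three_iff_lower_of_residueInputs_wild W hCT hKatoS hDel hGZK hmod hmodD
      hKatoχ hK hr hX hs hexotic htam hodd hmanin).mpr hlow)

/-! ### §2 The NON-RESIDUE rows at `3`: "Kodaira type tame" replaces the tower certificate -/

/-- **The N11 corner, per pair: on a NON-RESIDUE row the UPPER half is a theorem** — as p16's
`X4RankZero.missingUpperBoundAt_three_of_nonResidue_typeG`, with the tower input of the third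
alternative widened from "`TypeG W 3` or the tower" to "Kodaira type at `3` NOT in `{II, IV, IV*, II*}`
(i.e. `Iₙ*`, `III`, `III*`) or the tower" (`ClassX4.towerSurj_three_of_surj_of_kodairaSymbolAt_not_wild`).
[cite: Kato2004Asterisque, Thm. 14.5 (3) (p. 236), Thm. 17.4 (3) (p. 273)] [cite: Delbourgo1998, Prop. 4 (p. 144)]
[cite: SilvermanAEC2009, Thm. X.4.14] [cite: Miller2011LMS, Def. 1.1] [cite: Wuthrich2014, Lemma 20 (p. 399)] -/
theorem X4RankZero.missingUpperBoundAt_three_of_nonResidue_wild [Fact (Nat.Prime 3)]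
    (hCT : exists_casselsTate_pairing (K := ℚ))
    (hKatoS : Kato2004.rankZero_padicValNat_sha_le_sub_localTamagawa_of_additive_potGood_of_imageContainsSL2)
    (hDel : Delbourgo1998.prop4_rankZero_pow_dvd_constantCoeff)
    (hGZK : rank_eq_analyticRank_of_analyticRank_le_one) (hmod : hasEntireLFunction_rat)
    (hmodD : nonempty_modularParametrizationData)
    (hKatoχ : Wuthrich2014.kato_halfEigenCharIdeal_dvd_cyclotomicPrime_of_surjective)
    (hK : Kato2004.charIdeal_dvd_padicLFunctionBranch_component_of_surjective)
    (hr : W.analyticRank = 0) (hX : ClassX4 W 3) (hs : Surj W 3)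
    (hnon : padicValRat 3 W.j < 0 ∨ TypeGOrd W 3 ∨
      ((¬ (W.kodairaSymbolAt (placeOf 3) = .II ∨ W.kodairaSymbolAt (placeOf 3) = .IV ∨
            W.kodairaSymbolAt (placeOf 3) = .IVstar ∨ W.kodairaSymbolAt (placeOf 3) = .IIstar) ∨
          ∀ n : ℕ, W.HasSurjectiveModNGaloisRep (3 ^ n : ℕ)) ∧
        padicValNat 3 W.tamagawaProduct ≤
          padicValNat 3 ((W.baseChange ℚ_[3]).localTamagawaNumber ℤ_[3]) + 1 ∧
        (∃ q : ℚ, shaAn W = (q : ℂ) ∧ Even (padicValRat 3 q)) ∧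
        ∃ (N : ℕ) (_ : NeZero N) (D : ModularParametrizationData W N), ¬ (3 : ℤ) ∣ D.maninConstant)) :
    MissingUpperBoundAt W 3 :=
  X4RankZero.missingUpperBoundAt_three_of_nonResidue_typeG W hCT hKatoS hDel hGZK hmod hmodD hKatoχ hK hr
    hX hs (hnon.imp_right (Or.imp_right fun ⟨ht, h1, hq, hD⟩ ↦
      ⟨Or.inr (ht.elim (fun hK' ↦ ClassX4.towerSurj_three_of_surj_of_kodairaSymbolAt_not_wild hX hs hK')
        id), h1, hq, hD⟩))

/-- **THE N11 SENTENCE: on a non-residue row at `3` (tame Kodaira type or tower, defect `≤ 1`, even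
`ord₃ #Ш_an`, a datum), what remains is EXACTLY the LOWER half.**
[cite: Kato2004Asterisque, Thm. 14.5 (3) (p. 236)] [cite: Delbourgo1998, Prop. 4 (p. 144)] [cite: Miller2011LMS, Def. 1.1] -/
theorem X4RankZero.missingPPartAt_three_iff_lower_of_nonResidue_wild [Fact (Nat.Prime 3)]
    (hCT : exists_casselsTate_pairing (K := ℚ))
    (hKatoS : Kato2004.rankZero_padicValNat_sha_le_sub_localTamagawa_of_additive_potGood_of_imageContainsSL2)
    (hDel : Delbourgo1998.prop4_rankZero_pow_dvd_constantCoeff)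
    (hGZK : rank_eq_analyticRank_of_analyticRank_le_one) (hmod : hasEntireLFunction_rat)
    (hmodD : nonempty_modularParametrizationData)
    (hKatoχ : Wuthrich2014.kato_halfEigenCharIdeal_dvd_cyclotomicPrime_of_surjective)
    (hK : Kato2004.charIdeal_dvd_padicLFunctionBranch_component_of_surjective)
    (hr : W.analyticRank = 0) (hX : ClassX4 W 3) (hs : Surj W 3)
    (hnon : padicValRat 3 W.j < 0 ∨ TypeGOrd W 3 ∨
      ((¬ (W.kodairaSymbolAt (placeOf 3) = .II ∨ W.kodairaSymbolAt (placeOf 3) = .IV ∨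
            W.kodairaSymbolAt (placeOf 3) = .IVstar ∨ W.kodairaSymbolAt (placeOf 3) = .IIstar) ∨
          ∀ n : ℕ, W.HasSurjectiveModNGaloisRep (3 ^ n : ℕ)) ∧
        padicValNat 3 W.tamagawaProduct ≤
          padicValNat 3 ((W.baseChange ℚ_[3]).localTamagawaNumber ℤ_[3]) + 1 ∧
        (∃ q : ℚ, shaAn W = (q : ℂ) ∧ Even (padicValRat 3 q)) ∧
        ∃ (N : ℕ) (_ : NeZero N) (D : ModularParametrizationData W N), ¬ (3 : ℤ) ∣ D.maninConstant)) :
    MissingPPartAt W 3 ↔ MissingLowerBoundAt W 3 :=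
  ⟨fun h ↦ (lower_and_upper_of_missingPPartAt W 3 h).1, fun h ↦
    missingPPartAt_of_lower_of_upper W 3 h
      (X4RankZero.missingUpperBoundAt_three_of_nonResidue_wild W hCT hKatoS hDel hGZK hmod hmodD hKatoχ hK
        hr hX hs hnon)⟩

/-- **`BSD(E,3)` on a non-residue N11 row (tame Kodaira type or tower) from the LOWER half alone.**
[cite: Kato2004Asterisque, Thm. 14.5 (3) (p. 236)] [cite: Delbourgo1998, Prop. 4 (p. 144)]
[cite: Miller2011LMS, §1 and Def. 1.1] -/
theorem X4RankZero.bsdp_three_of_lower_of_nonResidue_wild [Fact (Nat.Prime 3)]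
    (hCT : exists_casselsTate_pairing (K := ℚ))
    (hKatoS : Kato2004.rankZero_padicValNat_sha_le_sub_localTamagawa_of_additive_potGood_of_imageContainsSL2)
    (hDel : Delbourgo1998.prop4_rankZero_pow_dvd_constantCoeff)
    (hGZK : rank_eq_analyticRank_of_analyticRank_le_one) (hmod : hasEntireLFunction_rat)
    (hmodD : nonempty_modularParametrizationData)
    (hKatoχ : Wuthrich2014.kato_halfEigenCharIdeal_dvd_cyclotomicPrime_of_surjective)
    (hK : Kato2004.charIdeal_dvd_padicLFunctionBranch_component_of_surjective)
    (hr : W.analyticRank = 0) (hX : ClassX4 W 3) (hs : Surj W 3)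
    (hnon : padicValRat 3 W.j < 0 ∨ TypeGOrd W 3 ∨
      ((¬ (W.kodairaSymbolAt (placeOf 3) = .II ∨ W.kodairaSymbolAt (placeOf 3) = .IV ∨
            W.kodairaSymbolAt (placeOf 3) = .IVstar ∨ W.kodairaSymbolAt (placeOf 3) = .IIstar) ∨
          ∀ n : ℕ, W.HasSurjectiveModNGaloisRep (3 ^ n : ℕ)) ∧
        padicValNat 3 W.tamagawaProduct ≤
          padicValNat 3 ((W.baseChange ℚ_[3]).localTamagawaNumber ℤ_[3]) + 1 ∧
        (∃ q : ℚ, shaAn W = (q : ℂ) ∧ Even (padicValRat 3 q)) ∧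
        ∃ (N : ℕ) (_ : NeZero N) (D : ModularParametrizationData W N), ¬ (3 : ℤ) ∣ D.maninConstant))
    (hlow : MissingLowerBoundAt W 3) : BSDp W 3 :=
  bsdp_of_missingPPartAt W 3 hGZK (by rw [hr]; exact zero_le_one)
    ((X4RankZero.missingPPartAt_three_iff_lower_of_nonResidue_wild W hCT hKatoS hDel hGZK hmod hmodD hKatoχ
      hK hr hX hs hnon).mpr hlow)

/-- **`BSD(E,3)` on a non-residue N11 row (tame Kodaira type or tower) with `3 ∤ #Ш_an` — nothing
else needed.** [cite: Kato2004Asterisque, Thm. 14.5 (3) (p. 236)] [cite: Delbourgo1998, Prop. 4 (p. 144)]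
[cite: Miller2011LMS, §1 and Def. 1.1] -/
theorem X4RankZero.bsdp_three_of_nonResidue_of_shaAn_unit_wild [Fact (Nat.Prime 3)]
    (hCT : exists_casselsTate_pairing (K := ℚ))
    (hKatoS : Kato2004.rankZero_padicValNat_sha_le_sub_localTamagawa_of_additive_potGood_of_imageContainsSL2)
    (hDel : Delbourgo1998.prop4_rankZero_pow_dvd_constantCoeff)
    (hGZK : rank_eq_analyticRank_of_analyticRank_le_one) (hmod : hasEntireLFunction_rat)
    (hmodD : nonempty_modularParametrizationData)
    (hKatoχ : Wuthrich2014.kato_halfEigenCharIdeal_dvd_cyclotomicPrime_of_surjective)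
    (hK : Kato2004.charIdeal_dvd_padicLFunctionBranch_component_of_surjective)
    (hr : W.analyticRank = 0) (hX : ClassX4 W 3) (hs : Surj W 3)
    {q : ℚ} (hq : shaAn W = (q : ℂ)) (hv : padicValRat 3 q = 0)
    (hnon : padicValRat 3 W.j < 0 ∨ TypeGOrd W 3 ∨
      ((¬ (W.kodairaSymbolAt (placeOf 3) = .II ∨ W.kodairaSymbolAt (placeOf 3) = .IV ∨
            W.kodairaSymbolAt (placeOf 3) = .IVstar ∨ W.kodairaSymbolAt (placeOf 3) = .IIstar) ∨
          ∀ n : ℕ, W.HasSurjectiveModNGaloisRep (3 ^ n : ℕ)) ∧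
        padicValNat 3 W.tamagawaProduct ≤
          padicValNat 3 ((W.baseChange ℚ_[3]).localTamagawaNumber ℤ_[3]) + 1 ∧
        ∃ (N : ℕ) (_ : NeZero N) (D : ModularParametrizationData W N), ¬ (3 : ℤ) ∣ D.maninConstant)) :
    BSDp W 3 :=
  bsdp_of_missingPPartAt W 3 hGZK (by rw [hr]; exact zero_le_one)
    (missingPPartAt_of_upper_of_shaAn_unit W 3
      (X4RankZero.missingUpperBoundAt_three_of_nonResidue_wild W hCT hKatoS hDel hGZK hmod hmodD hKatoχ hK
        hr hX hs (hnon.imp_right (Or.imp_right fun ⟨ht, h1, hD⟩ ↦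
          ⟨ht, h1, ⟨q, hq, by rw [hv]; exact ⟨0, by norm_num⟩⟩, hD⟩)))
      hq hv)

/-! ### §3 The class-level equivalence at `3` -/

/-- **X4♯(unit-free) AT `p = 3` ⟺ LOWER₃ ∧ EXOTIC(wild)₃ ∧ TAM-DEFECT₂♭₃ ∧ ODD-SHA♭₃ ∧ MANIN♭₃** —
p16's `x4SharpThreeUnitFree_iff_lower_and_residues_exoticTypeG` rewritten along T-b9's
`exotic_iff_exotic_of_kodairaWild`: the EXOTIC conjunct is quantified over the rows of Kodaira type
`II`, `IV`, `IV*`, `II*` at `3` only (wild; no `Iₙ*`, `I₀*`, `III`, `III*` row of X4 at `3` is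
exotic).  Nothing booked. [cite: Kato2004Asterisque, Thm. 14.5 (3) (p. 236), Thm. 17.4 (3) (p. 273)]
[cite: Delbourgo1998, Prop. 4 (p. 144)] [cite: SilvermanAEC2009, Thm. X.4.14]
[cite: Kim2022StructureSelmer, Conj. 1.10 (PDF p. 8)] [cite: Miller2011LMS, Def. 1.1] [cite: Wuthrich2014, Lemma 20 (p. 399)] -/
theorem x4SharpThreeUnitFree_iff_lower_and_residues_exoticWild [Fact (Nat.Prime 3)]
    (hCT : exists_casselsTate_pairing (K := ℚ))
    (hKatoS : Kato2004.rankZero_padicValNat_sha_le_sub_localTamagawa_of_additive_potGood_of_imageContainsSL2)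
    (hDel : Delbourgo1998.prop4_rankZero_pow_dvd_constantCoeff)
    (hGZK : rank_eq_analyticRank_of_analyticRank_le_one) (hmod : hasEntireLFunction_rat)
    (hmodD : nonempty_modularParametrizationData)
    (hKatoχ : Wuthrich2014.kato_halfEigenCharIdeal_dvd_cyclotomicPrime_of_surjective)
    (hK : Kato2004.charIdeal_dvd_padicLFunctionBranch_component_of_surjective) :
    (∀ (W : WeierstrassCurve ℚ) [W.IsElliptic] [W.IsGloballyMinimal],
        W.analyticRank = 0 → ClassX4 W 3 → Surj W 3 → MissingPPartAt W 3) ↔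
      (∀ (W : WeierstrassCurve ℚ) [W.IsElliptic] [W.IsGloballyMinimal],
          W.analyticRank = 0 → ClassX4 W 3 → Surj W 3 → MissingLowerBoundAt W 3) ∧
      (∀ (W : WeierstrassCurve ℚ) [W.IsElliptic] [W.IsGloballyMinimal],
          W.analyticRank = 0 → ClassX4 W 3 → Surj W 3 → 0 ≤ padicValRat 3 W.j →
          (W.kodairaSymbolAt (placeOf 3) = .II ∨ W.kodairaSymbolAt (placeOf 3) = .IV ∨
            W.kodairaSymbolAt (placeOf 3) = .IVstar ∨ W.kodairaSymbolAt (placeOf 3) = .IIstar) →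
          ¬ (∀ n : ℕ, W.HasSurjectiveModNGaloisRep (3 ^ n : ℕ)) → MissingUpperBoundAt W 3) ∧
      (∀ (W : WeierstrassCurve ℚ) [W.IsElliptic] [W.IsGloballyMinimal],
          W.analyticRank = 0 → ClassX4 W 3 → Surj W 3 → 0 ≤ padicValRat 3 W.j →
          ¬ (TypeGOrd W 3 ∧ semistabilityIndex W 3 = 2) →
          padicValNat 3 ((W.baseChange ℚ_[3]).localTamagawaNumber ℤ_[3]) + 2 ≤
            padicValNat 3 W.tamagawaProduct → MissingUpperBoundAt W 3) ∧
      (∀ (W : WeierstrassCurve ℚ) [W.IsElliptic] [W.IsGloballyMinimal],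
          W.analyticRank = 0 → ClassX4 W 3 → Surj W 3 → 0 ≤ padicValRat 3 W.j →
          ¬ (TypeGOrd W 3 ∧ semistabilityIndex W 3 = 2) →
          (∃ q : ℚ, shaAn W = (q : ℂ) ∧ Odd (padicValRat 3 q)) → MissingUpperBoundAt W 3) ∧
      (∀ (W : WeierstrassCurve ℚ) [W.IsElliptic] [W.IsGloballyMinimal],
          W.analyticRank = 0 → ClassX4 W 3 → Surj W 3 → 0 ≤ padicValRat 3 W.j →
          ¬ (TypeGOrd W 3 ∧ semistabilityIndex W 3 = 2) →
          (∀ (N : ℕ) [NeZero N] (D : ModularParametrizationData W N), (3 : ℤ) ∣ D.maninConstant) →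
          MissingUpperBoundAt W 3) := by
  rw [x4SharpThreeUnitFree_iff_lower_and_residues_exoticTypeG hCT hKatoS hDel hGZK hmod hmodD hKatoχ hK,
    exotic_iff_exotic_of_kodairaWild]

end Summit.BirchSwinnertonDyer.Rank1Residual.Additive

end
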